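import Summits.KontsevichZagierPeriods.KontsevichZagierPeriods.Theorems.BetaCancellation.Negative.LoadBearing
import Literature.NumberTheory.Transcendental.KZMellinFibres
import Literature.NumberTheory.Transcendental.KZLogCalculusProofs

/-!
# `BetaCancellation` (stmt-KontsevichZagierPeriods-13633) — line `dirichlet-companion-to-pi`,
stub `stub_dirichletLinear`

The SECOND of Dirichlet's two simplex substitutions (Andrews–Askey–Roy, Thm. 1.8.1, `y = (1 − x)t`)
as ONE change-of-variables move (rule (2) of the Kontsevich–Zagier calculus,
`KZ.changeOfVariablesRel`): the "linear" chart `Ψ(t,x) = (x, (1 − x)·t)` maps the open box `(0,1)²`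
(coordinates `z 0 = t`, `z 1 = x`) bijectively onto the open simplex `{x > 0, y > 0, x + y < 1}`
(inverse `x = w₀`, `t = w₁ / (1 − w₀)`); its Jacobian matrix (rows = components, columns = `∂/∂t`,
`∂/∂x`) is `(0, 1; 1 − x, −t)` with determinant `−(1 − x)`, so `|det DΨ| = 1 − x` on the box, and
`x^{ℓ-1} ((1−x)t)^{m-1} (1 − x − (1−x)t)^{-m} · (1 − x) = t^{m-1}(1-t)^{-m} · x^{ℓ-1}`
(`1 − x − (1−x)t = (1−x)(1−t)`, exponents `(m−1) + (−m) + 1 = 0`; `linear_kernel_identity`).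
Hence for the GIVEN representations `B = [box, t^{m-1}(1-t)^{-m} x^{ℓ-1}]` and
`S = [simplex, x^{ℓ-1} y^{m-1} (1-x-y)^{-m}]` one has `[B] − [S] ∈ changeOfVariablesRel`, so
`KZ.Equivalent B S`, and `KZ.Equivalent S B` by symmetry (`stub_dirichletLinear`). The pattern is
that of `Theorems/MultiplicationThree/Negative/Pinned.lean`, `…/BoxToBox.lean` (chart of a triangle
by the box); no definitions are introduced (the chart and its derivative are written out), so that
the file is a pure proof file.

References: M. Kontsevich, D. Zagier, *Periods* (2001), §1.2 rule (2); G. Andrews, R. Askey, R. Roy,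
*Special Functions* (1999), Thm. 1.8.1 (Dirichlet's integral).
-/

noncomputable section

-- `Summit.KontsevichZagierPeriods.KontsevichZagierPeriods.…` is the tree's mandated layout (single-conjunct summit).
set_option linter.dupNamespace false

namespace Summit.KontsevichZagierPeriods.KontsevichZagierPeriods.BetaCancellationLine

open MeasureTheory Set Real
open Literature.NumberTheory.Transcendental
open Literature.NumberTheory.Transcendental.KZ
open Literature.ModelTheory.ExponentialFields (IsSemialgebraic)
open MvPolynomial (aeval X C)

/-! ## The pull-back identity -/

/-- **The pull-back identity** of the linear chart (Jacobian `1 − x` included), for `0 < t < 1`,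
`0 < x < 1`:
`x^{ℓ-1} ((1−x)t)^{m-1} (1 − x − (1−x)t)^{-m} · (1 − x) = t^{m-1}(1-t)^{-m} · x^{ℓ-1}`
(`1 − x − (1−x)t = (1−x)(1−t)`; `rpow` algebra for positive bases, `(m−1) + (−m) + 1 = 0`). [folklore] -/
theorem linear_kernel_identity (ℓ m : ℚ) {t x : ℝ} (ht : 0 < t) (ht1 : t < 1) (hx1 : x < 1) :
    x ^ ((ℓ:ℝ) - 1) * ((1 - x) * t) ^ ((m:ℝ) - 1) * (1 - x - (1 - x) * t) ^ (-(m:ℝ)) * (1 - x) =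
      t ^ ((m:ℝ) - 1) * (1 - t) ^ (-(m:ℝ)) * x ^ ((ℓ:ℝ) - 1) := by
  have hx1' : 0 < 1 - x := sub_pos.2 hx1
  have ht1' : 0 < 1 - t := sub_pos.2 ht1
  have h1 : 1 - x - (1 - x) * t = (1 - x) * (1 - t) := by ring
  rw [h1, Real.mul_rpow hx1'.le ht.le, Real.mul_rpow hx1'.le ht1'.le]
  have h3 : (1 - x) ^ ((m:ℝ) - 1) * (1 - x) ^ (-(m:ℝ)) * (1 - x) = 1 := by
    rw [← Real.rpow_add hx1', ← Real.rpow_add_one hx1'.ne']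
    have h0 : (m:ℝ) - 1 + -(m:ℝ) + 1 = 0 := by ring
    rw [h0, Real.rpow_zero]
  linear_combination (t ^ ((m:ℝ) - 1) * (1 - t) ^ (-(m:ℝ)) * x ^ ((ℓ:ℝ) - 1)) * h3

/-! ## The linear chart `Ψ(t,x) = (x, (1-x)t)` of the simplex by the box -/

/-- The linear chart is differentiable, with a derivative of determinant `−(1 − x)` (the Jacobian
matrix `(0, 1; 1−x, −t)` as `Matrix.toLin'`). [folklore] -/
theorem hasFDerivAt_linChart (x : Fin 2 → ℝ) :
    ∃ L : (Fin 2 → ℝ) →L[ℝ] (Fin 2 → ℝ),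
      HasFDerivAt (fun y : Fin 2 → ℝ => (![y 1, (1 - y 1) * y 0] : Fin 2 → ℝ)) L x ∧
      L.det = -(1 - x 1) := by
  set L : (Fin 2 → ℝ) →L[ℝ] (Fin 2 → ℝ) := LinearMap.toContinuousLinearMap
    (Matrix.toLin' (!![0, 1; 1 - x 1, -(x 0)] : Matrix (Fin 2) (Fin 2) ℝ)) with hL
  have hL0 : ∀ v, L v 0 = v 1 := by
    intro v
    change Matrix.toLin' (!![0, 1; 1 - x 1, -(x 0)] : Matrix (Fin 2) (Fin 2) ℝ) v 0 = _
    rw [Matrix.toLin'_apply]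
    simp [Matrix.mulVec, dotProduct, Fin.sum_univ_two]
  have hL1 : ∀ v, L v 1 = (1 - x 1) * v 0 + -(x 0) * v 1 := by
    intro v
    change Matrix.toLin' (!![0, 1; 1 - x 1, -(x 0)] : Matrix (Fin 2) (Fin 2) ℝ) v 1 = _
    rw [Matrix.toLin'_apply]
    simp [Matrix.mulVec, dotProduct, Fin.sum_univ_two]
  refine ⟨L, ?_, ?_⟩
  · have h0 : HasFDerivAt (fun y : Fin 2 → ℝ => y 0)
        (ContinuousLinearMap.proj (R := ℝ) (φ := fun _ : Fin 2 => ℝ) 0) x :=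
      hasFDerivAt_apply 0 x
    have h1 : HasFDerivAt (fun y : Fin 2 → ℝ => y 1)
        (ContinuousLinearMap.proj (R := ℝ) (φ := fun _ : Fin 2 => ℝ) 1) x :=
      hasFDerivAt_apply 1 x
    rw [hasFDerivAt_pi']
    refine Fin.forall_fin_two.mpr ⟨?_, ?_⟩
    · have hf : (fun y : Fin 2 → ℝ => (![y 1, (1 - y 1) * y 0] : Fin 2 → ℝ) 0) =
          fun y => y 1 := funext fun y => rfl
      rw [hf]
      refine h1.congr_fderiv (ContinuousLinearMap.ext fun v => ?_)
      rw [ContinuousLinearMap.comp_apply, ContinuousLinearMap.proj_apply,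
        ContinuousLinearMap.proj_apply, hL0]
    · have hf : (fun y : Fin 2 → ℝ => (![y 1, (1 - y 1) * y 0] : Fin 2 → ℝ) 1) =
          fun y => (1 - y 1) * y 0 := funext fun y => rfl
      rw [hf]
      refine ((h1.const_sub 1).mul h0).congr_fderiv (ContinuousLinearMap.ext fun v => ?_)
      rw [ContinuousLinearMap.comp_apply, ContinuousLinearMap.proj_apply, hL1]
      simp
  · change LinearMap.det (Matrix.toLin' (!![0, 1; 1 - x 1, -(x 0)] : Matrix (Fin 2) (Fin 2) ℝ)) = _
    rw [LinearMap.det_toLin', Matrix.det_fin_two]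
    simp

/-- The linear chart is injective on the box (`x = w₀`, then cancel `1 − x ≠ 0`). [folklore] -/
theorem injOn_linChart :
    InjOn (fun y : Fin 2 → ℝ => (![y 1, (1 - y 1) * y 0] : Fin 2 → ℝ))
      {z : Fin 2 → ℝ | z 0 ∈ Set.Ioo (0:ℝ) 1 ∧ z 1 ∈ Set.Ioo (0:ℝ) 1} := by
  intro x _ y hy hxy
  have e0 := congrFun hxy 0
  have e1 := congrFun hxy 1
  simp only [Matrix.cons_val_zero, Matrix.cons_val_one] at e0 e1
  have h1 : x 1 = y 1 := e0
  have h0 : x 0 = y 0 := by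
    rw [h1] at e1
    exact mul_left_cancel₀ (sub_pos.2 hy.2.2).ne' e1
  funext i
  fin_cases i
  · exact h0
  · exact h1

/-- The linear chart maps the box ONTO the open simplex (inverse `x = w₀`, `t = w₁ / (1 − w₀)`). [folklore] -/
theorem image_linChart :
    (fun y : Fin 2 → ℝ => (![y 1, (1 - y 1) * y 0] : Fin 2 → ℝ)) ''
        {z : Fin 2 → ℝ | z 0 ∈ Set.Ioo (0:ℝ) 1 ∧ z 1 ∈ Set.Ioo (0:ℝ) 1} =
      {z : Fin 2 → ℝ | 0 < z 0 ∧ 0 < z 1 ∧ z 0 + z 1 < 1} := by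
  ext y
  constructor
  · rintro ⟨x, ⟨h0, h1⟩, rfl⟩
    refine ⟨?_, ?_, ?_⟩
    · show 0 < x 1
      exact h1.1
    · show 0 < (1 - x 1) * x 0
      exact mul_pos (sub_pos.2 h1.2) h0.1
    · show x 1 + (1 - x 1) * x 0 < 1
      nlinarith [mul_pos (sub_pos.2 h1.2) (sub_pos.2 h0.2)]
  · rintro ⟨hy0, hy1, hy2⟩
    have hs : 0 < 1 - y 0 := by linarith
    refine ⟨![y 1 / (1 - y 0), y 0], ⟨?_, ?_⟩, ?_⟩
    · show y 1 / (1 - y 0) ∈ Ioo (0:ℝ) 1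
      exact ⟨div_pos hy1 hs, by rw [div_lt_one hs]; linarith⟩
    · show y 0 ∈ Ioo (0:ℝ) 1
      exact ⟨hy0, by linarith⟩
    · funext i
      fin_cases i
      · rfl
      · show (1 - y 0) * (y 1 / (1 - y 0)) = y 1
        field_simp

/-- The linear chart is a `ℚ`-semialgebraic map on any `ℚ`-semialgebraic set (a polynomial map,
substitution polynomials `(X₁, (1 − X₁)X₀)`). [folklore] -/
theorem isSemialgebraicMapOn_linChart {s : Set (Fin 2 → ℝ)} (hs : IsSemialgebraic ℚ s) :
    IsSemialgebraicMapOn ℚ s (fun y : Fin 2 → ℝ => (![y 1, (1 - y 1) * y 0] : Fin 2 → ℝ)) := by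
  refine (isSemialgebraicMapOn_aeval hs
    (![X 1, (1 - X 1) * X 0] : Fin 2 → MvPolynomial (Fin 2) ℚ)).congr fun x _ => ?_
  funext i
  fin_cases i <;> simp

/-! ## The stub -/

/-- **Registered stub `stub_dirichletLinear`** (line `dirichlet-companion-to-pi` of crux
stmt-KontsevichZagierPeriods-13633): the linear chart `(t,x) ↦ (x, (1-x)t)` of the box onto the open
simplex (Dirichlet's substitution `y = (1 − x)t`) is one rule-(2) move,
`[box, t^{m-1}(1-t)^{-m} x^{ℓ-1}] ∼ [simplex, x^{ℓ-1} y^{m-1} (1-x-y)^{-m}]`; hence any simplex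
representation `S` and any box representation `B` with the displayed domains and integrands are
`KZ.Equivalent`. (The hypotheses `0 < ℓ`, `0 < m < 1` are not used: both representations are given,
with their convergence.) [cite: KontsevichZagier2001, §1.2 rule (2)] -/
theorem stub_dirichletLinear : ∀ (ℓ m : ℚ), 0 < ℓ → 0 < m → m < 1 →
    ∀ (S B : Literature.NumberTheory.Transcendental.KZ.IntegralRep 2),
    S.domain = {z | 0 < z 0 ∧ 0 < z 1 ∧ z 0 + z 1 < 1} →
    Set.EqOn S.integrand (fun z => (z 0) ^ ((ℓ:ℝ) - 1) * (z 1) ^ ((m:ℝ) - 1) *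
      (1 - z 0 - z 1) ^ (-(m:ℝ))) S.domain →
    B.domain = {z | z 0 ∈ Set.Ioo (0:ℝ) 1 ∧ z 1 ∈ Set.Ioo (0:ℝ) 1} →
    Set.EqOn B.integrand (fun z => (z 0) ^ ((m:ℝ) - 1) * (1 - z 0) ^ (-(m:ℝ)) *
      (z 1) ^ ((ℓ:ℝ) - 1)) B.domain →
    Literature.NumberTheory.Transcendental.KZ.Equivalent S B := by
  intro ℓ m _ _ _ S B hSd hSi hBd hBi
  choose Φ' hD hdet using hasFDerivAt_linChart
  -- the chart maps `B.domain` onto `S.domain`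
  have himage : S.domain =
      (fun y : Fin 2 → ℝ => (![y 1, (1 - y 1) * y 0] : Fin 2 → ℝ)) '' B.domain := by
    rw [hBd, image_linChart, hSd]
  refine Equivalent.symm (changeOfVariablesRel_subset_relations
    ⟨2, B, S, fun y : Fin 2 → ℝ => (![y 1, (1 - y 1) * y 0] : Fin 2 → ℝ), Φ',
      isSemialgebraicMapOn_linChart B.isSemialgebraic_domain,
      fun x _ => (hD x).hasFDerivWithinAt, ?_, himage, fun x hx => ?_, rfl⟩)
  · rw [hBd]; exact injOn_linChart
  · -- the pull-back identity on the box, Jacobian `|det DΨ| = 1 − x` included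
    have hΨx : (fun y : Fin 2 → ℝ => (![y 1, (1 - y 1) * y 0] : Fin 2 → ℝ)) x ∈ S.domain :=
      himage ▸ mem_image_of_mem _ hx
    rw [hBi hx, hSi hΨx, hdet x, abs_neg]
    rw [hBd] at hx
    obtain ⟨hx0, hx1⟩ := hx
    rw [abs_of_pos (sub_pos.2 hx1.2)]
    simp only [Matrix.cons_val_zero, Matrix.cons_val_one]
    exact (linear_kernel_identity ℓ m hx0.1 hx0.2 hx1.2).symm

end Summit.KontsevichZagierPeriods.KontsevichZagierPeriods.BetaCancellationLine
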